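import Mathlib
import Literature.Analysis.FluidPDE.DivFreeSobolevTestingL2
import Literature.Analysis.FluidPDE.CKNMorreyQuadraticMean
import Literature.Analysis.FunctionSpaces.SobolevNormSq
import Literature.Analysis.FunctionSpaces.WeakDerivInner
import Summits.NavierStokesRegularity.NavierStokesRegularity.Theorems.EulerZoomLiouvillePowerGaugeEulerLiouvilleWeakVorticityTools
import Summits.NavierStokesRegularity.NavierStokesRegularity.Theorems.EulerZoomLiouvillePowerGaugeEulerLiouvilleWeakVorticityPairings
import HarnessLib

/-!
# Crux `EulerZoomLiouville.PowerGaugeEulerLiouville` (stmt-NavierStokesRegularity-19832), weak stratum, lines `weak_eulerian` (E1) /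
# `weak_axisym` (X0): the two Sobolev pairings of the WEAK VORTICITY EQUATION

Route №10 `EulerZoomLiouville` (NavierStokesRegularity), crux E = stmt-NavierStokesRegularity-19832; width seat ns-ezl-w1 g9 under the LEAD ns-typeII-p2.
For `V ∈ W^{1,2}_loc ∩ L⁶_loc(ℝ³)` with whole-space weak gradient `G`, a.e. vorticity `Ω = curlCLM ∘ G`, a scalar test `ψ` and a vector `e`
(`Ψ = curl(ψ•e) = ∇ψ × e`):

* `integral_inner_apply_curl_smul_const_eq_zero` — **THE GRADIENT PART DROPS**: `∫ ⟪G(x)Ψ(x), V(x)⟫ dx = 0` (`⟪GΨ, V⟫ = ⟪Ψ, ∇½‖V‖²⟫` weakly,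
  `hasWeakFDerivOn_norm_sq` on a ball carrying `tsupport ψ`, and `div Ψ = 0`);
* `integral_fderiv_apply_curlCLM_mul_inner` — **THE STRETCHING PAIRING**: `∫ Dψ(x)[Ω x]·⟪V x, e⟫ dx = −∫ ψ(x)⟪G(x)Ω(x), e⟫ dx`
  (the weakly divergence-free `Ω ∈ L²_loc` — `isWeaklyDivFree_curlCLM` — annihilates the weak gradient of the compactly supported
  `W^{1,2}` function `ψ⟪V, e⟫`: Literature `IsWeaklyDivFree.integral_weakDeriv_apply_eq_zero_of_two`).
Together with the Lamb–Lagrange identity (`…WeakVorticityTools`) they turn `−∫⟪GV, Ψ⟫` into `∫ψ⟪GΩ,e⟫ + ∫⟪Ω,e⟫Dψ[V]`.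
[folklore; Evans2010 §5.2.3 Thm. 1 (iv); Serrin1963 §4; MajdaBertozziCUP2002 §2.1 (2.5)]

WHAT THIS IS NOT: not NS, not E, not E1 itself — two integral identities; 19832 is OPEN.
-/

noncomputable section

-- flat `Theorems/<Route><Decl>…` files of one crux share the namespace of the crux (tree convention)
set_option linter.dupNamespace false

open MeasureTheory Set Filter Topology Metric Function TopologicalSpace
open scoped ENNReal NNReal RealInnerProductSpace ContDiff

namespace Summit.NavierStokesRegularity.NavierStokesRegularity.Theorems.PowerGaugeEulerLiouville.WeakEulerian

open Literature.Analysis Literature.Analysis.FunctionSpaces Literature.Analysis.FluidPDE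
open Summit.NavierStokesRegularity.NavierStokesRegularity.Theorems.PowerGaugeEulerLiouville

variable {V : EuclideanSpace ℝ (Fin 3) → EuclideanSpace ℝ (Fin 3)}
  {G : EuclideanSpace ℝ (Fin 3) → EuclideanSpace ℝ (Fin 3) →L[ℝ] EuclideanSpace ℝ (Fin 3)}
  {ψ : EuclideanSpace ℝ (Fin 3) → ℝ}

/-! ### The gradient part drops -/

section GradientPart

/-- **`∫ ⟪G(x)(curl(ψ•e)(x)), V(x)⟫ dx = 0`** for `V ∈ L²_loc` with whole-space weak gradient `G ∈ L²_loc`: with `Ψ = curl(ψ•e)` and a ball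
`B ⊇ tsupport ψ`, the chain rule `D‖V‖² = 2⟪V, G·⟫` on `B` (`hasWeakFDerivOn_norm_sq`) tested with the components `Ψᵢ` gives
`Σᵢ ∫ ∂ᵢΨᵢ ‖V‖² = −2 Σᵢ ∫ Ψᵢ ⟪V, G eᵢ⟫ = −2∫⟪V, GΨ⟫`, and `Σᵢ ∂ᵢΨᵢ = div curl(ψe) = 0`. [folklore; Evans2010 §5.2.3 Thm. 1 (iv)] -/
theorem integral_inner_apply_curl_smul_const_eq_zero
    (hVG : HasWeakFDerivOn (⊤ : Opens (EuclideanSpace ℝ (Fin 3))) volume V G)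
    (hV2 : ∀ r : ℝ, MemLp V 2 (volume.restrict (ball (0 : EuclideanSpace ℝ (Fin 3)) r)))
    (hG2 : ∀ r : ℝ, MemLp G 2 (volume.restrict (ball (0 : EuclideanSpace ℝ (Fin 3)) r)))
    (hψ : IsTestFunctionOn (⊤ : Opens (EuclideanSpace ℝ (Fin 3))) ψ) (e : EuclideanSpace ℝ (Fin 3)) :
    ∫ x, ⟪G x (curl (fun y => ψ y • e) x), V x⟫ = 0 := by
  -- ### a ball carrying the supports
  obtain ⟨R, hR⟩ := hψ.hasCompactSupport.isCompact.isBounded.subset_ball (0 : EuclideanSpace ℝ (Fin 3))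
  set B : Set (EuclideanSpace ℝ (Fin 3)) := ball (0 : EuclideanSpace ℝ (Fin 3)) R with hB
  set U : Opens (EuclideanSpace ℝ (Fin 3)) := ⟨B, isOpen_ball⟩ with hU
  haveI : IsFiniteMeasure ((volume : Measure (EuclideanSpace ℝ (Fin 3))).restrict B) :=
    isFiniteMeasure_restrict.2 measure_ball_lt_top.ne
  set Ψ : EuclideanSpace ℝ (Fin 3) → EuclideanSpace ℝ (Fin 3) := curl (fun y => ψ y • e) with hΨ
  have hΨt : IsTestFunctionOn (⊤ : Opens (EuclideanSpace ℝ (Fin 3))) Ψ := isTestFunctionOn_curl_smul_const hψ e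
  have hΨd : Differentiable ℝ Ψ := hΨt.contDiff.differentiable (by simp)
  have hΨsupp : tsupport Ψ ⊆ B := (tsupport_curl_smul_const_subset hψ.contDiff e).trans hR
  have hΨ0 : ∀ x, x ∉ B → Ψ x = 0 := fun x hx => image_eq_zero_of_notMem_tsupport fun h => hx (hΨsupp h)
  -- the components `Ψᵢ = ⟪eᵢ, Ψ⟫` as test functions on `U`
  set f : Fin 3 → EuclideanSpace ℝ (Fin 3) := fun i => EuclideanSpace.single i (1 : ℝ) with hf
  have hΨi : ∀ i, IsTestFunctionOn U (fun x => ⟪f i, Ψ x⟫) := fun i =>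
    ⟨(hΨt.inner_const_left (f i)).contDiff, (hΨt.inner_const_left (f i)).hasCompactSupport,
      (closure_mono (Function.support_comp_subset (g := fun w : EuclideanSpace ℝ (Fin 3) => ⟪f i, w⟫) (by simp) Ψ)).trans hΨsupp⟩
  -- ### the chain rule for `‖V‖²` on `U`
  have hVGU : HasWeakFDerivOn U volume V G := HasWeakFDerivOn.mono_set_holds hVG le_top
  have hV2U : MemLp V 2 (volume.restrict (U : Set (EuclideanSpace ℝ (Fin 3)))) := hV2 R
  have hG2v : ∀ v, MemLp (fun x => G x v) 2 (volume.restrict (U : Set (EuclideanSpace ℝ (Fin 3)))) := fun v =>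
    (ContinuousLinearMap.apply ℝ (EuclideanSpace ℝ (Fin 3)) v).comp_memLp' (hG2 R)
  have hN := hasWeakFDerivOn_norm_sq hV2U hVGU hG2v
  -- tested with `Ψᵢ` in the direction `eᵢ`
  have hid : ∀ i, ∫ x in B, (fderiv ℝ (fun x => ⟪f i, Ψ x⟫) x (f i)) • ‖V x‖ ^ 2 =
      -∫ x in B, ⟪f i, Ψ x⟫ • (((2 : ℝ) • (innerSL ℝ (V x)).comp (G x)) (f i)) := fun i => hN.integral_fderiv_smul_eq _ (f i) (hΨi i)
  have hid' : ∀ i, ∫ x in B, ⟪f i, fderiv ℝ Ψ x (f i)⟫ * ‖V x‖ ^ 2 = -(2 * ∫ x in B, ⟪f i, Ψ x⟫ * ⟪V x, G x (f i)⟫) := by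
    intro i
    have h := hid i
    simp_rw [fderiv_inner_const_left_apply hΨd (f i), smul_eq_mul] at h
    rw [h, ← integral_const_mul]
    congr 1
    refine integral_congr_ae (Eventually.of_forall fun x => ?_)
    simp only [_root_.smul_apply, ContinuousLinearMap.coe_comp, Function.comp_apply, innerSL_apply_apply, smul_eq_mul]
    ring
  -- ### integrability of the pieces on `B`
  obtain ⟨CΨ, hCΨ⟩ := hΨt.contDiff.continuous.bounded_above_of_compact_support hΨt.hasCompactSupport
  have hDΨc : Continuous (fderiv ℝ Ψ) := hΨt.contDiff.continuous_fderiv (by simp)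
  obtain ⟨CΨ', hCΨ'⟩ := hDΨc.bounded_above_of_compact_support (hΨt.hasCompactSupport.fderiv (𝕜 := ℝ))
  have hV2int : IntegrableOn (fun x => ‖V x‖ ^ 2) B volume := (hV2 R).integrable_norm_pow two_ne_zero
  have hI1 : ∀ i, IntegrableOn (fun x => ⟪f i, fderiv ℝ Ψ x (f i)⟫ * ‖V x‖ ^ 2) B volume := by
    intro i
    refine Integrable.mono' (hV2int.const_mul (‖f i‖ * (CΨ' * ‖f i‖)))
      ((continuous_const.inner (hDΨc.clm_apply continuous_const)).aestronglyMeasurable.mul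
        hV2int.aestronglyMeasurable) (Eventually.of_forall fun x => ?_)
    rw [norm_mul, norm_pow, norm_norm]
    refine mul_le_mul_of_nonneg_right ?_ (by positivity)
    calc ‖⟪f i, fderiv ℝ Ψ x (f i)⟫‖ ≤ ‖f i‖ * ‖fderiv ℝ Ψ x (f i)‖ := norm_inner_le_norm _ _
      _ ≤ ‖f i‖ * (CΨ' * ‖f i‖) := by
          gcongr; exact ((fderiv ℝ Ψ x).le_opNorm _).trans (mul_le_mul_of_nonneg_right (hCΨ' x) (norm_nonneg _))
  have hVGv : ∀ v, IntegrableOn (fun x => ⟪V x, G x v⟫) B volume := by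
    intro v
    refine Integrable.mono' (integrableOn_norm_mul_norm_ball (hV2 R) (hG2v v)) ((hV2 R).1.inner (hG2v v).1)
      (Eventually.of_forall fun x => ?_)
    exact norm_inner_le_norm _ _
  have hI2 : ∀ i, IntegrableOn (fun x => ⟪f i, Ψ x⟫ * ⟪V x, G x (f i)⟫) B volume := by
    intro i
    refine Integrable.mono' ((hVGv (f i)).norm.const_mul (‖f i‖ * CΨ))
      ((continuous_const.inner hΨt.contDiff.continuous).aestronglyMeasurable.restrict.mul (hVGv (f i)).1)
      (Eventually.of_forall fun x => ?_)
    rw [norm_mul]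
    refine mul_le_mul_of_nonneg_right ((norm_inner_le_norm _ _).trans ?_) (norm_nonneg _)
    gcongr; exact hCΨ x
  -- ### sum over the frame
  have hdiv : ∀ x, ⟪f 0, fderiv ℝ Ψ x (f 0)⟫ + ⟪f 1, fderiv ℝ Ψ x (f 1)⟫ + ⟪f 2, fderiv ℝ Ψ x (f 2)⟫ = 0 := by
    intro x
    have h := divergence_eq_sum_inner_fderiv (EuclideanSpace.basisFun (Fin 3) ℝ) Ψ x
    simp only [EuclideanSpace.basisFun_apply, Fin.sum_univ_three] at h
    rw [hf]; dsimp only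
    rw [← h, hΨ]
    exact divergence_curl_smul_const hψ.contDiff e x
  have hsum0 : (∫ x in B, ⟪f 0, fderiv ℝ Ψ x (f 0)⟫ * ‖V x‖ ^ 2) + (∫ x in B, ⟪f 1, fderiv ℝ Ψ x (f 1)⟫ * ‖V x‖ ^ 2) +
      (∫ x in B, ⟪f 2, fderiv ℝ Ψ x (f 2)⟫ * ‖V x‖ ^ 2) = 0 := by
    rw [← integral_add (hI1 0) (hI1 1), ← integral_add ?_ (hI1 2)]
    swap; · exact (hI1 0).add (hI1 1)
    refine (integral_congr_ae (Eventually.of_forall fun x => ?_)).trans (integral_zero _ _)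
    have h := hdiv x
    linear_combination (‖V x‖ ^ 2) * h
  have hGΨ : ∀ x, ⟪V x, G x (Ψ x)⟫ = ⟪f 0, Ψ x⟫ * ⟪V x, G x (f 0)⟫ + ⟪f 1, Ψ x⟫ * ⟪V x, G x (f 1)⟫ + ⟪f 2, Ψ x⟫ * ⟪V x, G x (f 2)⟫ := by
    intro x
    rw [inner_apply_eq_sum_coord (G x) (V x) (Ψ x)]
    simp only [hf, EuclideanSpace.inner_single_left, one_mul, conj_trivial]
  have hsum1 : (∫ x in B, ⟪f 0, Ψ x⟫ * ⟪V x, G x (f 0)⟫) + (∫ x in B, ⟪f 1, Ψ x⟫ * ⟪V x, G x (f 1)⟫) +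
      (∫ x in B, ⟪f 2, Ψ x⟫ * ⟪V x, G x (f 2)⟫) = ∫ x in B, ⟪V x, G x (Ψ x)⟫ := by
    rw [← integral_add (hI2 0) (hI2 1), ← integral_add ?_ (hI2 2)]
    swap; · exact (hI2 0).add (hI2 1)
    exact integral_congr_ae (Eventually.of_forall fun x => (hGΨ x).symm)
  have hBint : ∫ x in B, ⟪V x, G x (Ψ x)⟫ = 0 := by
    have h := hsum0
    rw [hid' 0, hid' 1, hid' 2] at h
    linarith [hsum1]
  -- ### back to the whole space
  have hzero : ∀ x, x ∉ B → ⟪G x (curl (fun y => ψ y • e) x), V x⟫ = 0 := fun x hx => by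
    rw [show curl (fun y => ψ y • e) x = Ψ x from rfl, hΨ0 x hx, map_zero, inner_zero_left]
  rw [← setIntegral_eq_integral_of_forall_compl_eq_zero hzero]
  rw [show (fun x => ⟪G x (curl (fun y => ψ y • e) x), V x⟫) = fun x => ⟪V x, G x (Ψ x)⟫ from
    funext fun x => real_inner_comm _ _]
  exact hBint

end GradientPart

/-! ### The stretching pairing -/

section Stretching

/-- **`∫ Dψ(x)[Ω(x)]·⟪V(x), e⟫ dx = −∫ ψ(x)⟪G(x)Ω(x), e⟫ dx`**, `Ω = curlCLM ∘ G`, for `V ∈ L²_loc` with whole-space weak gradient `G ∈ L²_loc`: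
the weakly divergence-free field `Ω ∈ L²_loc` (`isWeaklyDivFree_curlCLM`) annihilates the weak gradient
`GW = Dψ ⊗ ⟪V,e⟫ + ψ⟪G·, e⟫ ∈ L²` of the compactly supported `W^{1,2}` function `W = ψ⟪V, e⟫`
(`IsWeaklyDivFree.integral_weakDeriv_apply_eq_zero_of_two`): `∫ GW(Ω) = 0`. [folklore; Serrin1963 §4; Evans2010 §5.2.3 Thm. 1 (iv)] -/
theorem integral_fderiv_apply_curlCLM_mul_inner
    (hVG : HasWeakFDerivOn (⊤ : Opens (EuclideanSpace ℝ (Fin 3))) volume V G)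
    (hV2 : ∀ r : ℝ, MemLp V 2 (volume.restrict (ball (0 : EuclideanSpace ℝ (Fin 3)) r)))
    (hG2 : ∀ r : ℝ, MemLp G 2 (volume.restrict (ball (0 : EuclideanSpace ℝ (Fin 3)) r)))
    (hψ : IsTestFunctionOn (⊤ : Opens (EuclideanSpace ℝ (Fin 3))) ψ) (e : EuclideanSpace ℝ (Fin 3)) :
    ∫ x, fderiv ℝ ψ x (curlCLM (G x)) * ⟪V x, e⟫ = -∫ x, ψ x * ⟪G x (curlCLM (G x)), e⟫ := by
  -- ### supports and measurability
  obtain ⟨R, hR⟩ := hψ.hasCompactSupport.isCompact.isBounded.subset_ball (0 : EuclideanSpace ℝ (Fin 3))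
  set B : Set (EuclideanSpace ℝ (Fin 3)) := ball (0 : EuclideanSpace ℝ (Fin 3)) R with hB
  set Ω : EuclideanSpace ℝ (Fin 3) → EuclideanSpace ℝ (Fin 3) := fun x => curlCLM (G x) with hΩ
  have hGl : LocallyIntegrable G volume := locallyIntegrableOn_univ.1 (by
    simpa only [Opens.coe_top] using hVG.locallyIntegrableOn_deriv)
  have hGm : AEStronglyMeasurable G volume := hGl.aestronglyMeasurable
  have hVm : AEStronglyMeasurable V volume := (locallyIntegrableOn_univ.1 (by
    simpa only [Opens.coe_top] using hVG.locallyIntegrableOn)).aestronglyMeasurable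
  have hΩm : AEStronglyMeasurable Ω volume := curlCLM.continuous.comp_aestronglyMeasurable hGm
  have hΩ2 : ∀ r : ℝ, MemLp Ω 2 (volume.restrict (ball (0 : EuclideanSpace ℝ (Fin 3)) r)) := fun r =>
    curlCLM.comp_memLp' (hG2 r)
  have hψc : Continuous ψ := hψ.contDiff.continuous
  have hDψc : Continuous (fderiv ℝ ψ) := hψ.contDiff.continuous_fderiv (by simp)
  obtain ⟨Cψ, hCψ⟩ := hψc.bounded_above_of_compact_support hψ.hasCompactSupport
  obtain ⟨Cψ', hCψ'⟩ := hDψc.bounded_above_of_compact_support (hψ.hasCompactSupport.fderiv (𝕜 := ℝ))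
  have hCψ0 : 0 ≤ Cψ := (norm_nonneg _).trans (hCψ 0)
  have hCψ'0 : 0 ≤ Cψ' := (norm_nonneg _).trans (hCψ' 0)
  have hψ0 : ∀ x, x ∉ B → ψ x = 0 := fun x hx => image_eq_zero_of_notMem_tsupport fun h => hx (hR h)
  have hDψ0 : ∀ x, x ∉ B → fderiv ℝ ψ x = 0 := fun x hx => fderiv_of_notMem_tsupport ℝ fun h => hx (hR h)
  -- ### the weak derivative of `W = ψ ⟪V, e⟫`
  set GW : EuclideanSpace ℝ (Fin 3) → EuclideanSpace ℝ (Fin 3) →L[ℝ] ℝ := fun x =>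
    (fderiv ℝ ψ x).smulRight ⟪V x, e⟫ + ψ x • (innerSL ℝ e).comp (G x) with hGW
  have hW : HasWeakFDerivOn (⊤ : Opens (EuclideanSpace ℝ (Fin 3))) volume (fun x => ψ x • ⟪V x, e⟫) GW :=
    (hVG.inner_const e).smul_contDiff hψ.contDiff
  have hWρ : tsupport (fun x => ψ x • ⟪V x, e⟫) ⊆ B := (tsupport_smul_subset_left _ _).trans hR
  have hGW0 : ∀ x, x ∉ B → GW x = 0 := fun x hx => by
    simp only [hGW, hψ0 x hx, hDψ0 x hx, ContinuousLinearMap.zero_smulRight, zero_smul, add_zero]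
  have hGWm : AEStronglyMeasurable GW volume := by
    have h1 : AEStronglyMeasurable (fun x => (fderiv ℝ ψ x).smulRight ⟪V x, e⟫) volume :=
      (ContinuousLinearMap.smulRightL ℝ (EuclideanSpace ℝ (Fin 3)) ℝ).continuous₂.comp_aestronglyMeasurable
        (hDψc.aestronglyMeasurable.prodMk (hVm.inner aestronglyMeasurable_const))
    have h2 : AEStronglyMeasurable (fun x => ψ x • (innerSL ℝ e).comp (G x)) volume :=
      hψc.aestronglyMeasurable.smul (((ContinuousLinearMap.compL ℝ (EuclideanSpace ℝ (Fin 3)) (EuclideanSpace ℝ (Fin 3)) ℝ)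
        (innerSL ℝ e)).continuous.comp_aestronglyMeasurable hGm)
    exact h1.add h2
  -- `GW ∈ L²`
  have hGWB : MemLp GW 2 (volume.restrict B) := by
    refine MemLp.of_le_mul (c := (Cψ' + Cψ) * ‖e‖) ((hV2 R).norm.add (hG2 R).norm) hGWm.restrict
      (Eventually.of_forall fun x => ?_)
    have hg : ‖((fun x => ‖V x‖) + fun x => ‖G x‖) x‖ = ‖V x‖ + ‖G x‖ := by
      simp only [Pi.add_apply, Real.norm_eq_abs]; exact abs_of_nonneg (by positivity)
    rw [hg]
    have h1 : ‖(fderiv ℝ ψ x).smulRight ⟪V x, e⟫‖ ≤ Cψ' * (‖e‖ * ‖V x‖) := by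
      rw [ContinuousLinearMap.norm_smulRight_apply]
      exact mul_le_mul (hCψ' x) (by rw [Real.norm_eq_abs, mul_comm]; exact abs_real_inner_le_norm _ _) (norm_nonneg _) hCψ'0
    have h2 : ‖ψ x • (innerSL ℝ e).comp (G x)‖ ≤ Cψ * (‖e‖ * ‖G x‖) := by
      rw [norm_smul]
      refine mul_le_mul (hCψ x) ((ContinuousLinearMap.opNorm_comp_le _ _).trans ?_) (norm_nonneg _) hCψ0
      rw [innerSL_apply_norm]
    calc ‖GW x‖ ≤ ‖(fderiv ℝ ψ x).smulRight ⟪V x, e⟫‖ + ‖ψ x • (innerSL ℝ e).comp (G x)‖ := norm_add_le _ _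
      _ ≤ Cψ' * (‖e‖ * ‖V x‖) + Cψ * (‖e‖ * ‖G x‖) := add_le_add h1 h2
      _ ≤ (Cψ' + Cψ) * ‖e‖ * (‖V x‖ + ‖G x‖) := by
          nlinarith [norm_nonneg e, norm_nonneg (V x), norm_nonneg (G x), mul_nonneg hCψ0 (norm_nonneg e),
            mul_nonneg hCψ'0 (norm_nonneg e)]
  have hGW2 : MemLp GW 2 volume := by
    have h := (memLp_indicator_iff_restrict (μ := (volume : Measure (EuclideanSpace ℝ (Fin 3)))) (p := (2 : ℝ≥0∞))
      (f := GW) measurableSet_ball).2 hGWB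
    have heq : B.indicator GW = GW := funext fun x => by
      by_cases hx : x ∈ B
      · rw [indicator_of_mem hx]
      · rw [indicator_of_notMem hx, hGW0 x hx]
    rwa [heq] at h
  have hb2 : eLpNorm ((ball (0 : EuclideanSpace ℝ (Fin 3)) (R + 2)).indicator Ω) 2 volume < ⊤ := by
    rw [eLpNorm_indicator_eq_eLpNorm_restrict measurableSet_ball]
    exact (hΩ2 (R + 2)).eLpNorm_lt_top
  -- ### the annihilation
  have hmain := (isWeaklyDivFree_curlCLM hVG).integral_weakDeriv_apply_eq_zero_of_two hΩm hb2 hW hGW2 hWρ hGW0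
  -- ### split the pairing `GW(Ω) = Dψ(Ω)⟪V,e⟫ + ψ⟪e, GΩ⟫`
  have hsplit : ∀ x, GW x (Ω x) = fderiv ℝ ψ x (Ω x) * ⟪V x, e⟫ + ψ x * ⟪G x (Ω x), e⟫ := fun x => by
    simp only [hGW, _root_.add_apply, ContinuousLinearMap.smulRight_apply, _root_.smul_apply, ContinuousLinearMap.coe_comp,
      Function.comp_apply, innerSL_apply_apply, smul_eq_mul, real_inner_comm e]
  have hI1 : Integrable (fun x => fderiv ℝ ψ x (Ω x) * ⟪V x, e⟫) volume :=
    integrable_fderiv_apply_curlCLM_mul_inner hVG hV2 hG2 hψ e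
  have hI2 : Integrable (fun x => ψ x * ⟪G x (Ω x), e⟫) volume := integrable_mul_inner_apply_curlCLM hVG hG2 hψ e
  have hmain' : (∫ x, fderiv ℝ ψ x (Ω x) * ⟪V x, e⟫) + ∫ x, ψ x * ⟪G x (Ω x), e⟫ = 0 := by
    rw [← integral_add hI1 hI2, ← hmain]
    exact integral_congr_ae (Eventually.of_forall fun x => (hsplit x).symm)
  linarith

end Stretching

end Summit.NavierStokesRegularity.NavierStokesRegularity.Theorems.PowerGaugeEulerLiouville.WeakEulerian

end
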